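import Mathlib
import HarnessLib
import Summits.Ventures.LatticeQCDFlow.Scaling.AutoregressiveSiteProposalAcceptance

/-!
# LatticeQCDFlow / Scaling — the Metropolised single-coordinate update with a learned proposal:
# THE FLOOR `m² ≤ ā_a` (so `m² ≤ ā_a ≤ m`: the acceptance certifies the proposal's `L¹` error to within a
# square root)

HONEST FRAMING: exact (Metropolis-corrected) sampling algorithms for lattice gauge theory;
figures of merit are autocorrelation/cost numbers at stated couplings and volumes; no
continuum-physics claim.

Venture `LatticeQCDFlow` (cell pub-lqcd), topic `Scaling`, FANOUT row 30 (lean-1, GEN-19) — OUR WORK,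
companion of `Scaling/AutoregressiveSiteProposalAcceptance` (setting and notation there: `π = ⊗μ`,
coordinate `a`, weight `0 < c_F ≤ F ≤ C_F`, `Z = ∫F dπ`, `M = A_aF`, proposal density `0 ≤ q ≤ C_q`
normalised in `a`; `ā_a = Z⁻¹∫∫∫ min(F_v q_{v'}, F_{v'} q_v)`, `m = Z⁻¹∫ min(F, M·q) dπ =
1 − (1/(2Z))∫|F − M·q| dπ`; there: `ā_a ≤ m`).

## What is proved (all [ours])

* `sq_site_overlap_le` — per context, `(∫ min(F_v, M q_v) dμ)² ≤ M(U)·∫∫ min(F_v q_{v'}, F_{v'} q_v)`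
  (the tree's pointwise `min·min ≤ min` inequality, unnormalised);
* **`sq_overlap_le_siteMeanAccept`** — `m² ≤ ā_a` (Cauchy–Schwarz against the context law `M dπ/Z`).

READING (value-free): with the companion's ceiling, `1 − √ā_a ≤ (1/(2Z))∫|F − q·A_aF| dπ ≤ 1 − ā_a` — the
acceptance column of a learned single-link updater measures its proposal's mean total-variation distance
to the exact one-link conditional, model-free.  NOT CLAIMED: autocorrelations; sharp constants.
No `def`, no `sorry`, nothing cited as a fact.
-/

noncomputable section

namespace Summit.Ventures.LatticeQCDFlow.Theory2.Autoregressive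

open MeasureTheory Function Set
open Summit.Ventures.LatticeQCDFlow.Exactness

variable {ι : Type*} [Fintype ι] [DecidableEq ι] {X : Type*} [MeasurableSpace X]
variable (μ : Measure X) [IsProbabilityMeasure μ]

variable {a : ι} {F q : (ι → X) → ℝ}

set_option maxHeartbeats 400000 in
/-- **Lower per context**: `(∫ min(F_v, M·q_v) dμ)² ≤ M(U)·∫∫ min(F_v q_{v'}, F_{v'} q_v) dμ dμ`. [ours] -/
theorem sq_site_overlap_le (hFm : Measurable F) (hF0 : ∀ U, 0 ≤ F U) {CF : ℝ} (hFb : ∀ U, F U ≤ CF)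
    (hqm : Measurable q) (hq0 : ∀ U, 0 ≤ q U) {Cq : ℝ} (hqb : ∀ U, q U ≤ Cq) (U : ι → X) :
    (∫ v, min (F (update U a v)) (coordAvg μ {a} F U * q (update U a v)) ∂μ) ^ 2 ≤
      coordAvg μ {a} F U *
        ∫ v, ∫ v', min (F (update U a v) * q (update U a v')) (F (update U a v') * q (update U a v)) ∂μ ∂μ := by
  set M : ℝ := coordAvg μ {a} F U with hM
  have hM0 : 0 ≤ M := (coordAvg_mem_Icc μ {a} hFm hF0 hFb U).1
  have hFu : Measurable fun v' => F (update U a v') := hFm.comp (measurable_update U)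
  have hqu : Measurable fun v' => q (update U a v') := hqm.comp (measurable_update U)
  have hCF : 0 ≤ CF := (hF0 U).trans (hFb U)
  set g : X → ℝ := fun v => min (F (update U a v)) (M * q (update U a v)) with hg
  have hgm : Measurable g := hFu.min (measurable_const.mul hqu)
  have hg0 : ∀ v, 0 ≤ g v := fun v => le_min (hF0 _) (mul_nonneg hM0 (hq0 _))
  have hgb : ∀ v, |g v| ≤ CF := fun v => by
    rw [abs_of_nonneg (hg0 v)]; exact (min_le_left _ _).trans (hFb _)
  have hgi : Integrable g μ := integrable_of_measurable_abs_le μ hgm hgb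
  -- `(∫ g)² = ∫∫ g v g v'`
  have e : (∫ v, g v ∂μ) ^ 2 = ∫ v, ∫ v', g v * g v' ∂μ ∂μ := by
    simp_rw [integral_const_mul]
    rw [integral_mul_const, sq]
  rw [e, ← integral_const_mul]
  -- pointwise `g v g v' ≤ M·min(F_v q_v', F_v' q_v)` (tree `min_mul_min_le`)
  have hpt : ∀ v v', g v * g v' ≤ M * min (F (update U a v) * q (update U a v'))
      (F (update U a v') * q (update U a v)) := by
    intro v v'
    have h := min_mul_min_le (p := fun w => F (update U a w)) (q := fun w => M * q (update U a w))
      (fun w => hF0 _) (fun w => mul_nonneg hM0 (hq0 _)) v v'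
    have e2 : min (F (update U a v) * (M * q (update U a v'))) (F (update U a v') * (M * q (update U a v))) =
        M * min (F (update U a v) * q (update U a v')) (F (update U a v') * q (update U a v)) := by
      rw [mul_min_of_nonneg _ _ hM0]; congr 1 <;> ring
    simpa only [hg, e2] using h
  -- integrate
  have hG : Measurable fun z : X × X => min (F (update U a z.1) * q (update U a z.2))
      (F (update U a z.2) * q (update U a z.1)) :=
    ((hFu.comp measurable_fst).mul (hqu.comp measurable_snd)).min
      ((hFu.comp measurable_snd).mul (hqu.comp measurable_fst))
  have hinner_m : Measurable fun v => ∫ v', min (F (update U a v) * q (update U a v'))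
      (F (update U a v') * q (update U a v)) ∂μ :=
    (hG.stronglyMeasurable.integral_prod_right (ν := μ)).measurable
  have hmin_b : ∀ v v', |min (F (update U a v) * q (update U a v')) (F (update U a v') * q (update U a v))| ≤
      CF * Cq := fun v v' => by
    rw [abs_of_nonneg (le_min (mul_nonneg (hF0 _) (hq0 _)) (mul_nonneg (hF0 _) (hq0 _)))]
    exact (min_le_left _ _).trans (mul_le_mul (hFb _) (hqb _) (hq0 _) hCF)
  have hinner_b : ∀ v, |∫ v', min (F (update U a v) * q (update U a v'))
      (F (update U a v') * q (update U a v)) ∂μ| ≤ CF * Cq := fun v => by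
    refine (abs_integral_le_integral_abs).trans ?_
    calc ∫ v', |min (F (update U a v) * q (update U a v')) (F (update U a v') * q (update U a v))| ∂μ
        ≤ ∫ _, CF * Cq ∂μ := integral_mono (integrable_of_measurable_abs_le μ (hG.comp
            (measurable_const.prodMk measurable_id)).abs (fun v' => by rw [abs_abs]; exact hmin_b v v'))
            (integrable_const _) (fun v' => hmin_b v v')
      _ = CF * Cq := by simp
  have hint_v : ∀ v, Integrable (fun v' => min (F (update U a v) * q (update U a v'))
      (F (update U a v') * q (update U a v))) μ := fun v =>
    integrable_of_measurable_abs_le μ (hG.comp (measurable_const.prodMk measurable_id)) (fun v' => hmin_b v v')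
  refine integral_mono ?_ ((integrable_of_measurable_abs_le μ hinner_m hinner_b).const_mul M) (fun v => ?_)
  · exact (hgi.mul_const _).congr (ae_of_all _ fun v => (integral_const_mul (g v) _).symm)
  · show ∫ v', g v * g v' ∂μ ≤ M * ∫ v', min (F (update U a v) * q (update U a v'))
      (F (update U a v') * q (update U a v)) ∂μ
    rw [← integral_const_mul]
    exact integral_mono (hgi.const_mul (g v)) ((hint_v v).const_mul M) (fun v' => hpt v v')


set_option maxHeartbeats 400000 in
/-- **LOWER: `m² ≤ ā_a`** (weight squeezed between positive constants; Cauchy–Schwarz against the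
context law `A_aF dπ/Z`). [ours] -/
theorem sq_overlap_le_siteMeanAccept (hFm : Measurable F) {cF CF : ℝ} (hcF : 0 < cF)
    (hFlo : ∀ U, cF ≤ F U) (hFb : ∀ U, F U ≤ CF)
    (hqm : Measurable q) (hq0 : ∀ U, 0 ≤ q U) {Cq : ℝ} (hqb : ∀ U, q U ≤ Cq)
    (hq1 : ∀ U, ∫ v, q (update U a v) ∂μ = 1) :
    ((∫ U, min (F U) (coordAvg μ {a} F U * q U) ∂Measure.pi (fun _ : ι => μ)) /
        ∫ U, F U ∂Measure.pi (fun _ : ι => μ)) ^ 2 ≤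
      (∫ U, ∫ v, ∫ v', min (F (update U a v) * q (update U a v')) (F (update U a v') * q (update U a v)) ∂μ ∂μ
        ∂Measure.pi (fun _ : ι => μ)) / ∫ U, F U ∂Measure.pi (fun _ : ι => μ) := by
  have hF0 : ∀ U, 0 ≤ F U := fun U => hcF.le.trans (hFlo U)
  have hFabs : ∀ W, |F W| ≤ CF := fun W => by rw [abs_of_nonneg (hF0 W)]; exact hFb W
  have hqabs : ∀ W, |q W| ≤ Cq := fun W => by rw [abs_of_nonneg (hq0 W)]; exact hqb W
  obtain ⟨hAm, hAb⟩ := siteAcc_measurable_bounded μ (a := a) hFm hF0 hFb hqm hq0 hqb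
  obtain ⟨hgm, hg0, hgM, hgint⟩ := siteOverlap_facts μ (a := a) hFm hF0 hFb hqm hq0
  set Z : ℝ := ∫ U, F U ∂Measure.pi (fun _ : ι => μ) with hZdef
  set M := coordAvg μ {a} F with hM
  set g : (ι → X) → ℝ := fun U => ∫ v, min (F (update U a v)) (M U * q (update U a v)) ∂μ with hg
  set A : (ι → X) → ℝ := fun U => ∫ v, ∫ v', min (F (update U a v) * q (update U a v'))
    (F (update U a v') * q (update U a v)) ∂μ ∂μ with hA
  have hMm : Measurable M := measurable_coordAvg μ {a} hFm
  have hMf : ∀ U, cF ≤ M U ∧ M U ≤ CF := fun U => coordAvg_mem_Icc μ {a} hFm hFlo hFb U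
  have hMpos : ∀ U, 0 < M U := fun U => hcF.trans_le (hMf U).1
  have hMabs : ∀ U, |M U| ≤ CF := fun U => by rw [abs_of_pos (hMpos U)]; exact (hMf U).2
  have hZM : ∫ U, M U ∂Measure.pi (fun _ : ι => μ) = Z :=
    (pi_integral_coordAvg_singleton_facts μ a hFm hFabs hqm hqabs hq1).1
  have hZpos : 0 < Z := by
    rw [← hZM]
    have h1 : ∫ _, cF ∂Measure.pi (fun _ : ι => μ) ≤ ∫ U, M U ∂Measure.pi (fun _ : ι => μ) :=
      integral_mono (integrable_const cF) (integrable_of_measurable_abs_le _ hMm hMabs) (fun U => (hMf U).1)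
    have h2 : ∫ _, cF ∂Measure.pi (fun _ : ι => μ) = cF := by
      rw [integral_const, smul_eq_mul, Measure.real, measure_univ, ENNReal.toReal_one, one_mul]
    linarith
  set G : ℝ := ∫ U, g U ∂Measure.pi (fun _ : ι => μ) with hGdef
  have hgabs : ∀ U, |g U| ≤ CF := fun U => by rw [abs_of_nonneg (hg0 U)]; exact (hgM U).trans (hMf U).2
  have hgi : Integrable g (Measure.pi fun _ : ι => μ) := integrable_of_measurable_abs_le _ hgm hgabs
  -- (i) `g²/M ≤ A` pointwise, hence `∫ g²/M ≤ ∫ A`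
  have hsqm : Measurable fun U => g U ^ 2 / M U := (hgm.pow_const 2).div hMm
  have hsqb : ∀ U, |g U ^ 2 / M U| ≤ CF := fun U => by
    rw [abs_of_nonneg (div_nonneg (sq_nonneg _) (hMpos U).le), div_le_iff₀ (hMpos U), sq]
    exact mul_le_mul ((hgM U).trans (hMf U).2) (hgM U) (hg0 U) ((hg0 U).trans ((hgM U).trans (hMf U).2))
  have h1 : ∫ U, g U ^ 2 / M U ∂Measure.pi (fun _ : ι => μ) ≤ ∫ U, A U ∂Measure.pi (fun _ : ι => μ) :=
    integral_mono (integrable_of_measurable_abs_le _ hsqm hsqb) (integrable_of_measurable_abs_le _ hAm hAb)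
      (fun U => by
        show g U ^ 2 / M U ≤ A U
        rw [div_le_iff₀ (hMpos U), mul_comm]
        exact sq_site_overlap_le μ hFm hF0 hFb hqm hq0 hqb U)
  -- (ii) Cauchy–Schwarz: `G²/Z ≤ ∫ g²/M`
  have h2 : G ^ 2 / Z ≤ ∫ U, g U ^ 2 / M U ∂Measure.pi (fun _ : ι => μ) := by
    set m : ℝ := G / Z with hm
    have hpt : ∀ U, 0 ≤ g U ^ 2 / M U - 2 * m * g U + m ^ 2 * M U := fun U => by
      have hM0 : M U ≠ 0 := (hMpos U).ne'
      have e : g U ^ 2 / M U - 2 * m * g U + m ^ 2 * M U = (g U - m * M U) ^ 2 / M U := by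
        field_simp
        ring
      rw [e]; exact div_nonneg (sq_nonneg _) (hMpos U).le
    have hI : ∫ U, (g U ^ 2 / M U - 2 * m * g U + m ^ 2 * M U) ∂Measure.pi (fun _ : ι => μ) =
        (∫ U, g U ^ 2 / M U ∂Measure.pi (fun _ : ι => μ)) - 2 * m * G + m ^ 2 * Z := by
      have hIa : Integrable (fun U => g U ^ 2 / M U - 2 * m * g U) (Measure.pi fun _ : ι => μ) :=
        (integrable_of_measurable_abs_le _ hsqm hsqb).sub (hgi.const_mul _)
      have hIb : Integrable (fun U => m ^ 2 * M U) (Measure.pi fun _ : ι => μ) :=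
        (integrable_of_measurable_abs_le _ hMm hMabs).const_mul _
      have hIc : Integrable (fun U => 2 * m * g U) (Measure.pi fun _ : ι => μ) := hgi.const_mul _
      rw [integral_add hIa hIb, integral_sub (integrable_of_measurable_abs_le _ hsqm hsqb) hIc,
        integral_const_mul, integral_const_mul, hZM]
    have h0 : 0 ≤ (∫ U, g U ^ 2 / M U ∂Measure.pi (fun _ : ι => μ)) - 2 * m * G + m ^ 2 * Z := by
      rw [← hI]; exact integral_nonneg hpt
    have e2 : 2 * m * G - m ^ 2 * Z = G ^ 2 / Z := by
      rw [hm]; field_simp; ring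
    linarith
  -- assemble: `(G/Z)² = (G²/Z)/Z ≤ (∫ A)/Z`
  have hZ0 : Z ≠ 0 := hZpos.ne'
  have e3 : (G / Z) ^ 2 = (G ^ 2 / Z) / Z := by field_simp
  rw [← hgint, e3]
  exact div_le_div_of_nonneg_right (h2.trans h1) hZpos.le


end Summit.Ventures.LatticeQCDFlow.Theory2.Autoregressive

end
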